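import Summits.AnomalousDissipation.AnomalousDissipation.Theorems.SolenoidalFractalHomogenisationLagrangianCarrierAnalyticDispStrain
import Summits.AnomalousDissipation.AnomalousDissipation.Theorems.SolenoidalFractalHomogenisationLagrangianStepFrameDerivLeibniz
import Summits.AnomalousDissipation.AnomalousDissipation.Theorems.SolenoidalFractalHomogenisationLagrangianStepVmodFrameDefsJA
import Summits.AnomalousDissipation.AnomalousDissipation.Theorems.SolenoidalFractalHomogenisationLagrangianStepFrameBackwardEntries
import Summits.AnomalousDissipation.AnomalousDissipation.Theorems.SolenoidalFractalHomogenisationLagrangianStepFrameBackwardLipschitz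
import Summits.AnomalousDissipation.AnomalousDissipation.Theorems.SolenoidalFractalHomogenisationLagrangianStepFrameSecondGradient
import HarnessLib

/-!
# K1L_D (stmt-AnomalousDissipation-27980), (ℓ3-A) road A: THE CLAMPED EXACT-FLOW FRAME IS FRAME-REGULAR WITH ITS JACOBIAN AS INVERSE —
# `IsFrameRegular` (orders ≤ 2) AND the (F6) token `IsFrameRegular6` (orders ≤ 6) discharged for the one instance
(helper, `--supports 27980 --as helper`; prover lead-k1l-onelevel-p1 g8; tenure RULINGS D28-18 (1), D28-22′ (F6), D28-25 (2b): returned to the lead.)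

For the clamped curve `τ ↦ G(τ) = frameG E m (jR + clamp(τ)/a) (jR)` of `…FrameModulationF` (the frame of the (ℓ3) heads) and its pointwise
inverse `J(τ) = frameJac E m (jR + clamp(τ)/a) (jR)` (`G = J⁻¹ = adj J`, `det J = 1` on the closed window): with constants `θs, Cr, ϱr > 0`
depending on the design only, every `LPermissible`, `Regular` carrier of design `W.stretch M` under the template `(T4)` at `θ₀ ≤ θs` and
`N_m² ≤ N_{m+1}` satisfies, on every piece `jR < t ≤ (j+1)R`,
`IsFrameRegular (Cr·strain m) (a(t−jR)) (ϱr·N m) G J ∧ IsFrameRegular6 (Cr·strain m) (a(t−jR)) (ϱr·N m) G J`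
(`FrameInst.isFrameRegular_frameG_closed_pos`).  Ingredients: `mul_eq_one` ← `FrameConj.isUnit_frameJac`; `smooth`/`jointCont`/`jointContG` ←
`smoothFamily_frameJac_clamped` / `smoothFamily_frameG_clamped`; `lipschitz`, `aeDeriv`, `aeDerivG` ← the within-window frame equations
(`TorusFlow.hasDerivWithinAt_iterPartialDeriv_disp`, `FrameForm.hasDerivWithinAt_adjugate_frameJac_entry_closed`) read through the clamped clock
(`hasDerivAt_comp_clamp_div`); `derivBound`/`derivBound6` ← **`LagrangianCarrierAnalytic.abs_iterPartialDeriv_disp_le_strain`** (all label-gradients of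
the window displacement are `O(strain)`: `|∂^l J| = |∂^{l++[c]} disp| ≤ C_D·|l|!·strain·(ϱ_D N_m)^{|l|}`) and the graded Leibniz bound for adjugates
`FrameInst.abs_iterPartialDeriv_adjugate_le`.  The (ℓ3-A) head takes `θ := max(Cα,Cr)·strain m`, `nC := max(ϱ,ϱr)·N m` via `IsFrameModulation.mono`,
`IsFrameRegular.mono`, `IsFrameRegular6.mono`.  No sorry, no definition, no named fact.  NOT a proof of any block, of K1L_D or of AD; rung F-D1.A0.
-/

set_option linter.dupNamespace false

noncomputable section

namespace Summit.AnomalousDissipation.AnomalousDissipation.Theorems.SolenoidalFractalHomogenisation.LagrangianStep.FrameInst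

open Set Function Filter MeasureTheory Topology
open scoped NNReal ENNReal ContDiff
open Literature.Analysis Literature.Analysis.ODE Literature.Analysis.ODE.TorusFlow
open Literature.Analysis.FunctionSpaces Literature.Analysis.FunctionSpaces.Torus
open Literature.Analysis.FluidPDE Literature.Analysis.FluidPDE.LatticeShear
open Literature.Analysis.FluidPDE.LatticeShear (LagrangianLatticeCarrier)
open Summit.AnomalousDissipation.AnomalousDissipation.Theorems.SolenoidalFractalHomogenisation.LagrangianCarrierAnalytic
open Summit.AnomalousDissipation.AnomalousDissipation.Theorems.SolenoidalFractalHomogenisation.LagrangianStep.FrameConj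
open Summit.AnomalousDissipation.AnomalousDissipation.Theorems.SolenoidalFractalHomogenisation.LagrangianStep.FrameForm
open Summit.AnomalousDissipation.AnomalousDissipation.Theorems.SolenoidalFractalHomogenisation.LagrangianStep.VmodDist

variable {k : ℕ}

/-! ## §1 The clamped clock -/

/-- **Derivatives through the clamped clock.**  If `φ` has derivative `φ' u` within `[0,T]` at every `u ∈ [0,T]`, then for `τ` in the OPEN
cell-time interval `(0, aT)` the clamped reading `σ ↦ φ (clamp(σ)/a)` has the two-sided derivative `(1/a)·φ'(τ/a)` at `τ`. -/
theorem hasDerivAt_comp_clamp_div {φ φ' : ℝ → ℝ} {a T : ℝ} (ha : 0 < a)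
    (h : ∀ u ∈ Icc 0 T, HasDerivWithinAt φ (φ' u) (Icc 0 T) u) {τ : ℝ} (hτ : τ ∈ Ioo 0 (a * T)) :
    HasDerivAt (fun σ => φ (max 0 (min σ (a * T)) / a)) ((1 / a) • φ' (τ / a)) τ := by
  have hu : τ / a ∈ Ioo 0 T := ⟨div_pos hτ.1 ha, by rw [div_lt_iff₀ ha]; linarith [hτ.2]⟩
  have hφ : HasDerivAt φ (φ' (τ / a)) (τ / a) :=
    (h (τ / a) (Ioo_subset_Icc_self hu)).hasDerivAt (Icc_mem_nhds hu.1 hu.2)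
  have hg : HasDerivAt (fun σ : ℝ => σ / a) (1 / a) τ := (hasDerivAt_id τ).div_const a
  have hcomp : HasDerivAt (fun σ => φ (σ / a)) ((1 / a) • φ' (τ / a)) τ := hφ.scomp τ hg
  refine hcomp.congr_of_eventuallyEq ?_
  filter_upwards [Ioo_mem_nhds hτ.1 hτ.2] with σ hσ
  rw [clamp_eq_self (Ioo_subset_Icc_self hσ)]

/-- `∀ t ∈ Ioo 0 Tw` gives `∀ᵐ t ∂(volume.restrict (Ioo 0 Tw))`. [folklore] -/
theorem ae_restrict_Ioo_of_forall {Tw : ℝ} {P : ℝ → Prop} (h : ∀ t ∈ Ioo 0 Tw, P t) :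
    ∀ᵐ t ∂(volume.restrict (Ioo 0 Tw)), P t :=
  (ae_restrict_iff' measurableSet_Ioo).2 (Filter.Eventually.of_forall h)

/-! ## §2 The instance -/

set_option maxHeartbeats 800000 in
/-- **The clamped exact-flow frame is frame-regular with its Jacobian as pointwise inverse, at orders ≤ 2 AND ≤ 6 (F6).**  For every design `W`
(pre-stretch `M`) there are `θs, Cr, ϱr > 0` such that for every `LPermissible`, `Regular` carrier `E` of design `W.stretch M` with `N_m² ≤ N_{m+1}`
and the template `(T4)` at `θ₀ ≤ θs`, every level `m`, window index `j` and `jR < t ≤ (j+1)R`: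
`IsFrameRegular (Cr·strain m) (a(t−jR)) (ϱr·N m) Gclamp Jclamp ∧ IsFrameRegular6 (Cr·strain m) (a(t−jR)) (ϱr·N m) Gclamp Jclamp`. -/
theorem isFrameRegular_frameG_closed_pos (k : ℕ) (W : LatticeWord k) (M : ℝ) (hM : 0 < M) :
    ∃ θs : ℝ, 0 < θs ∧ ∃ Cr : ℝ, 0 < Cr ∧ ∃ ϱr : ℝ, 0 < ϱr ∧
    ∀ (E : LagrangianLatticeCarrier k) (θ₀ : ℝ), E.design = W.stretch M hM → θ₀ ≤ θs → E.LPermissible → E.Regular →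
      (∀ m, E.N m ^ 2 ≤ E.N (m + 1)) → (∀ m, E.θ (m + 1) * ((E.N (m + 1) : ℝ) / E.N m) ^ (1 / 16 : ℝ) ≤ θ₀) →
      ∀ (m : ℕ) (j : ℤ) (t : ℝ), (j : ℝ) * E.refresh (m + 1) < t → t ≤ ((j : ℝ) + 1) * E.refresh (m + 1) →
        IsFrameRegular (Cr * E.strain m) (E.a (m + 1) * (t - (j : ℝ) * E.refresh (m + 1))) (ϱr * E.N m)
            (fun τ y => frameG E m ((j : ℝ) * E.refresh (m + 1)
              + max 0 (min τ (E.a (m + 1) * (t - (j : ℝ) * E.refresh (m + 1)))) / E.a (m + 1)) ((j : ℝ) * E.refresh (m + 1)) y)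
            (fun τ y => frameJac E m ((j : ℝ) * E.refresh (m + 1)
              + max 0 (min τ (E.a (m + 1) * (t - (j : ℝ) * E.refresh (m + 1)))) / E.a (m + 1)) ((j : ℝ) * E.refresh (m + 1)) y) ∧
        IsFrameRegular6 (Cr * E.strain m) (E.a (m + 1) * (t - (j : ℝ) * E.refresh (m + 1))) (ϱr * E.N m)
            (fun τ y => frameG E m ((j : ℝ) * E.refresh (m + 1)
              + max 0 (min τ (E.a (m + 1) * (t - (j : ℝ) * E.refresh (m + 1)))) / E.a (m + 1)) ((j : ℝ) * E.refresh (m + 1)) y)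
            (fun τ y => frameJac E m ((j : ℝ) * E.refresh (m + 1)
              + max 0 (min τ (E.a (m + 1) * (t - (j : ℝ) * E.refresh (m + 1)))) / E.a (m + 1)) ((j : ℝ) * E.refresh (m + 1)) y) := by
  obtain ⟨θs₁, hθs₁, CD, hCD, ϱD, hϱD, HD⟩ := abs_iterPartialDeriv_disp_le_strain k W M hM
  obtain ⟨θs₂, hθs₂, C', hC', Hrate⟩ := abs_partialDeriv_partialSum_le k (W.stretch M hM)
  -- the constants
  set BJ : ℝ := 720 * CD with hBJ
  have hBJ0 : 0 ≤ BJ := by positivity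
  set Kadj : ℝ := 6 * (2 ^ 6 * ((2 ^ 6 * (BJ * (4 + BJ))) * (2 + BJ) + 4 * BJ)) with hKadj
  have hKadj0 : 0 ≤ Kadj := by positivity
  set Cr : ℝ := Kadj + 360 * CD + 1 with hCr
  have hCr0 : 0 < Cr := by positivity
  refine ⟨min (min θs₁ θs₂) (min 1 (1 / CD)), lt_min (lt_min hθs₁ hθs₂) (lt_min one_pos (by positivity)), Cr, hCr0, ϱD, hϱD, ?_⟩
  intro E θ₀ hdes hθs hLP hReg hsq hT4 m j t hjt htR
  have hθs₁' : θ₀ ≤ θs₁ := hθs.trans ((min_le_left _ _).trans (min_le_left _ _))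
  have hθs₂' : θ₀ ≤ θs₂ := hθs.trans ((min_le_left _ _).trans (min_le_right _ _))
  have hθ1' : θ₀ ≤ 1 := hθs.trans ((min_le_right _ _).trans (min_le_left _ _))
  have hθCD : θ₀ ≤ 1 / CD := hθs.trans ((min_le_right _ _).trans (min_le_right _ _))
  have hLR : E.LevelRegular := hReg.levelRegular
  have hF : E.IsFlow m := (hLP.isLagrangian m).1
  have hθall : ∀ i, E.θ (i + 1) ≤ θs₁ := fun i => (theta_le_of_template E hLP hT4 i).trans hθs₁'
  -- abbreviations
  set s : ℝ := (j : ℝ) * E.refresh (m + 1) with hs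
  set T : ℝ := t - s with hTdef
  set a : ℝ := E.a (m + 1) with ha
  have ha0 : 0 < a := E.a_pos (m + 1)
  have hT0 : 0 < T := by rw [hTdef]; linarith
  have hTR : T ≤ E.refresh (m + 1) := by rw [hTdef, hs]; linarith
  have haT : 0 < a * T := mul_pos ha0 hT0
  have hst : s ≤ t := hjt.le
  have htR' : t ≤ s + E.refresh (m + 1) := by rw [hs]; linarith
  have hclI : ∀ τ : ℝ, max 0 (min τ (a * T)) / a ∈ Icc 0 T := fun τ => clamp_div_mem E m hst τ
  -- the strain of the level is small
  have hstrain0 : 0 ≤ E.strain m :=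
    mul_nonneg (Finset.sum_nonneg fun i _ => (E.a_pos _).le) (E.refresh_pos (m + 1)).le
  have hstrainθ : E.strain m ≤ θ₀ := (hLP.strain_le m).trans (theta_le_of_template E hLP hT4 m)
  have hstrain1 : E.strain m ≤ 1 := hstrainθ.trans hθ1'
  have hCDstrain : CD * E.strain m ≤ 1 := by
    calc CD * E.strain m ≤ CD * (1 / CD) := mul_le_mul_of_nonneg_left (hstrainθ.trans hθCD) hCD.le
      _ = 1 := by field_simp
  have hL0 : 0 ≤ ϱD * E.N m := by have := E.N_pos m; positivity
  -- the Jacobian entries on the window: `J(u) = 1 + ∇disp`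
  have hJe : ∀ (u : ℝ) (y : UnitAddTorus (Fin 3)) (p r : Fin 3), frameJac E m (s + u) s y p r =
      (1 : Matrix (Fin 3) (Fin 3) ℝ) p r + Torus.partialDeriv r (fun z => E.disp m (s + u) s z p) y := fun u y p r => by
    rw [frameJac_eq_of, Matrix.of_apply, hLR.flowDeriv_single_apply]
  -- (D) all label-gradients of the window displacement
  have hD : ∀ u ∈ Icc 0 T, ∀ (l : List (Fin 3)) (n : ℕ), l.length = n + 1 → ∀ (p : Fin 3) (y : UnitAddTorus (Fin 3)),
      |iterPartialDeriv l (fun z => E.disp m (s + u) s z p) y| ≤ CD * (Nat.factorial n : ℝ) * E.strain m * (ϱD * E.N m) ^ n :=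
    fun u hu l n hl p y => HD E hdes hLP hReg hθall hsq m j u hu.1 (hu.2.trans hTR) l n hl p y
  -- order zero: `|J_{pr}| ≤ 2`
  have hJ0 : ∀ u ∈ Icc 0 T, ∀ (y : UnitAddTorus (Fin 3)) (p r : Fin 3), |frameJac E m (s + u) s y p r| ≤ 2 := by
    intro u hu y p r
    rw [hJe]
    have h1 : |(1 : Matrix (Fin 3) (Fin 3) ℝ) p r| ≤ 1 := by rw [Matrix.one_apply]; split_ifs <;> simp
    have h2 := hD u hu [r] 0 rfl p y
    rw [iterPartialDeriv_cons, iterPartialDeriv_nil] at h2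
    simp only [Nat.factorial_zero, Nat.cast_one, mul_one, pow_zero] at h2
    calc |(1 : Matrix (Fin 3) (Fin 3) ℝ) p r + Torus.partialDeriv r (fun z => E.disp m (s + u) s z p) y|
        ≤ 1 + CD * E.strain m := (abs_add_le _ _).trans (add_le_add h1 h2)
      _ ≤ 2 := by linarith
  -- orders `1 … 6` of `J`
  have hJn : ∀ u ∈ Icc 0 T, ∀ (p r : Fin 3) (l : List (Fin 3)), 1 ≤ l.length → l.length ≤ 6 → ∀ y : UnitAddTorus (Fin 3),
      |iterPartialDeriv l (fun y => frameJac E m (s + u) s y p r) y| ≤ BJ * E.strain m * (ϱD * E.N m) ^ l.length := by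
    intro u hu p r l hl1 hl6 y
    have hlne : l ≠ [] := by intro h; rw [h] at hl1; simp at hl1
    have hDs : IsSmooth (fun z => E.disp m (s + u) s z p) := (hLR.isSmooth_disp m _ _).apply p
    have e : (fun y => frameJac E m (s + u) s y p r) = fun y => (1 : Matrix (Fin 3) (Fin 3) ℝ) p r
        + Torus.partialDeriv r (fun z => E.disp m (s + u) s z p) y := funext fun y => hJe u y p r
    rw [e, iterPartialDeriv_add (isSmooth_const _) (hDs.partialDeriv r) l]
    simp only
    rw [iterPartialDeriv_const _ l hlne, Pi.zero_apply, zero_add, ← iterPartialDeriv_concat]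
    obtain ⟨n, hn⟩ : ∃ n, l.length = n + 1 := ⟨l.length - 1, by omega⟩
    have h := hD u hu (l ++ [r]) l.length (by simp) p y
    refine h.trans ?_
    have hfac : (Nat.factorial l.length : ℝ) ≤ 720 := by
      have : Nat.factorial l.length ≤ Nat.factorial 6 := Nat.factorial_le hl6
      exact_mod_cast this
    have hX : 0 ≤ E.strain m * (ϱD * E.N m) ^ l.length := mul_nonneg hstrain0 (pow_nonneg hL0 _)
    calc CD * (Nat.factorial l.length : ℝ) * E.strain m * (ϱD * E.N m) ^ l.length
        = (CD * (Nat.factorial l.length : ℝ)) * (E.strain m * (ϱD * E.N m) ^ l.length) := by ring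
      _ ≤ (CD * 720) * (E.strain m * (ϱD * E.N m) ^ l.length) := mul_le_mul_of_nonneg_right (mul_le_mul_of_nonneg_left hfac hCD.le) hX
      _ = BJ * E.strain m * (ϱD * E.N m) ^ l.length := by rw [hBJ]; ring
  -- orders `1 … 6` of `G = adj J`
  have hGn : ∀ u ∈ Icc 0 T, ∀ (i l₀ : Fin 3) (l : List (Fin 3)), 1 ≤ l.length → l.length ≤ 6 → ∀ y : UnitAddTorus (Fin 3),
      |iterPartialDeriv l (fun y => frameG E m (s + u) s y i l₀) y| ≤ Kadj * E.strain m * (ϱD * E.N m) ^ l.length := by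
    intro u hu i l₀ l hl1 hl6 y
    have e : (fun y => frameG E m (s + u) s y i l₀) = fun y => (frameJac E m (s + u) s y).adjugate i l₀ := by
      funext y; rw [frameG_eq_adjugate_closed E hLR hF j hTR hu y]
    rw [e, hKadj]
    have hJs : ∀ p r, IsSmooth (fun y => frameJac E m (s + u) s y p r) := fun p r => by
      have e' : (fun y => frameJac E m (s + u) s y p r) = fun y => (1 : Matrix (Fin 3) (Fin 3) ℝ) p r
          + Torus.partialDeriv r (fun z => E.disp m (s + u) s z p) y := funext fun y => hJe u y p r
      rw [e']; exact (isSmooth_const _).add (((hLR.isSmooth_disp m _ _).apply p).partialDeriv r)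
    exact abs_iterPartialDeriv_adjugate_le (J := fun y => frameJac E m (s + u) s y) hJs
      hBJ0 hstrain0 hstrain1 hL0 (K := 6) (fun p r y => hJ0 u hu y p r) (fun p r l h1 h6 y => hJn u hu p r l h1 h6 y) i l₀ l hl1 hl6 y
  -- the graded bounds in the registered shape
  have hbound : ∀ τ ∈ Icc 0 (a * T), ∀ (y : UnitAddTorus (Fin 3)) (i j' : Fin 3) (l : List (Fin 3)), 1 ≤ l.length → l.length ≤ 6 →
      |iterPartialDeriv l (fun y => frameG E m (s + max 0 (min τ (a * T)) / a) s y i j') y| ≤ Cr * E.strain m * (ϱD * E.N m) ^ l.length ∧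
      |iterPartialDeriv l (fun y => frameJac E m (s + max 0 (min τ (a * T)) / a) s y i j') y| ≤ 2 * (Cr * E.strain m) * (ϱD * E.N m) ^ l.length := by
    intro τ _ y i j' l hl1 hl6
    have hX : 0 ≤ E.strain m * (ϱD * E.N m) ^ l.length := mul_nonneg hstrain0 (pow_nonneg hL0 _)
    refine ⟨(hGn _ (hclI τ) i j' l hl1 hl6 y).trans ?_, (hJn _ (hclI τ) i j' l hl1 hl6 y).trans ?_⟩
    · calc Kadj * E.strain m * (ϱD * E.N m) ^ l.length = Kadj * (E.strain m * (ϱD * E.N m) ^ l.length) := by ring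
        _ ≤ Cr * (E.strain m * (ϱD * E.N m) ^ l.length) := mul_le_mul_of_nonneg_right (by rw [hCr]; linarith [hCD.le]) hX
        _ = Cr * E.strain m * (ϱD * E.N m) ^ l.length := by ring
    · calc BJ * E.strain m * (ϱD * E.N m) ^ l.length = BJ * (E.strain m * (ϱD * E.N m) ^ l.length) := by ring
        _ ≤ (2 * Cr) * (E.strain m * (ϱD * E.N m) ^ l.length) :=
            mul_le_mul_of_nonneg_right (by rw [hCr, hBJ]; linarith [hKadj0]) hX
        _ = 2 * (Cr * E.strain m) * (ϱD * E.N m) ^ l.length := by ring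
  -- the within-window frame equations
  obtain ⟨hbc, hbs, hbB, -⟩ := hLR.window_b_clauses m s T
  obtain ⟨hDc, hDs', hDB⟩ := window_disp_clauses_closed E hLR m j hTR
  have hint : ∀ s' ∈ Icc 0 T, ∀ x, E.disp m (s + s') s x =
      ∫ r in (0 : ℝ)..s', E.partialSum m (s + r) (x + proj (E.disp m (s + r) s x)) := fun s' _ x => hF.window_integral_eq s s' x
  have hDt := hasDerivWithinAt_iterPartialDeriv_disp hbc hbs hbB hDc hDs' hDB hint
  -- the time derivative of the Jacobian entries within the window and its bound
  set S : ℝ := ∑ i ∈ Finset.range m, E.a (i + 1) with hS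
  have hS0 : 0 ≤ S := Finset.sum_nonneg fun i _ => (E.a_pos _).le
  have hJd : ∀ (y : UnitAddTorus (Fin 3)) (p r : Fin 3), ∀ u ∈ Icc 0 T, HasDerivWithinAt (fun u => frameJac E m (s + u) s y p r)
      (iterPartialDeriv [r] (fun z => E.partialSum m (s + u) (z + proj (E.disp m (s + u) s z)) p) y) (Icc 0 T) u := by
    intro y p r u hu
    have h := (hDt [r] p y hu).const_add ((1 : Matrix (Fin 3) (Fin 3) ℝ) p r)
    refine h.congr (fun u' _ => ?_) ?_
    · rw [hJe, iterPartialDeriv_cons, iterPartialDeriv_nil]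
    · rw [hJe, iterPartialDeriv_cons, iterPartialDeriv_nil]
  have hJd_le : ∀ (y : UnitAddTorus (Fin 3)) (p r : Fin 3), ∀ u ∈ Icc 0 T,
      |iterPartialDeriv [r] (fun z => E.partialSum m (s + u) (z + proj (E.disp m (s + u) s z)) p) y| ≤ 6 * (C' * S) := by
    intro y p r u hu
    rw [iterPartialDeriv_singleton_comp_add_proj (f := fun u => E.partialSum m (s + u)) (D := fun u => E.disp m (s + u) s)
      (fun u => hLR.isSmooth_partialSum m _) (fun u => hLR.isSmooth_disp m _ _) r p u y]
    have hq : ∀ q : Fin 3, |Torus.partialDeriv q (fun z => E.partialSum m (s + u) z p) (y + proj (E.disp m (s + u) s y)) *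
        ((1 : Matrix (Fin 3) (Fin 3) ℝ) q r + Torus.partialDeriv r (fun z => E.disp m (s + u) s z q) y)| ≤ C' * S * 2 := by
      intro q
      rw [abs_mul]
      refine mul_le_mul (Hrate E θ₀ hdes hθs₂' hLP hReg hsq hT4 m (s + u) _ p q) ?_ (abs_nonneg _) (mul_nonneg hC' hS0)
      rw [← hJe]; exact hJ0 u hu y q r
    calc |∑ q, Torus.partialDeriv q (fun z => E.partialSum m (s + u) z p) (y + proj (E.disp m (s + u) s y)) *
            ((1 : Matrix (Fin 3) (Fin 3) ℝ) q r + Torus.partialDeriv r (fun z => E.disp m (s + u) s z q) y)|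
        ≤ ∑ q, |Torus.partialDeriv q (fun z => E.partialSum m (s + u) z p) (y + proj (E.disp m (s + u) s y)) *
            ((1 : Matrix (Fin 3) (Fin 3) ℝ) q r + Torus.partialDeriv r (fun z => E.disp m (s + u) s z q) y)| := Finset.abs_sum_le_sum_abs _ _
      _ ≤ ∑ _q : Fin 3, C' * S * 2 := Finset.sum_le_sum fun q _ => hq q
      _ = 6 * (C' * S) := by simp only [Finset.sum_const, Finset.card_univ, Fintype.card_fin, nsmul_eq_mul]; push_cast; ring
  -- the qualitative package of the clamped entries
  have hSFJ := fun p r => smoothFamily_frameJac_clamped E hLR m j hst htR' p r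
  have hSFG := fun c i => smoothFamily_frameG_clamped E hLR hF j hst htR' c i
  -- ASSEMBLY
  have hreg : IsFrameRegular (Cr * E.strain m) (a * T) (ϱD * E.N m)
      (fun τ y => frameG E m (s + max 0 (min τ (a * T)) / a) s y) (fun τ y => frameJac E m (s + max 0 (min τ (a * T)) / a) s y) := by
    refine ⟨?_, ?_, ?_, ?_, ?_, ?_, ?_, ?_⟩
    · -- `G J = 1`
      intro τ y
      rw [frameG]
      exact Matrix.nonsing_inv_mul _ ((Matrix.isUnit_iff_isUnit_det _).1 (isUnit_frameJac E hLR m _ _ y))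
    · intro τ p r; exact (hSFJ p r).1 τ
    · intro i j' l; exact (hSFJ i j').2 l
    · -- Lipschitz in cell time
      refine ⟨6 * (C' * S) / a, fun τ hτ σ hσ y p r => ?_⟩
      have hMV := Convex.norm_image_sub_le_of_norm_hasDerivWithin_le (hJd y p r)
        (fun u hu => by rw [Real.norm_eq_abs]; exact hJd_le y p r u hu) (convex_Icc 0 T) (hclI σ) (hclI τ)
      rw [Real.norm_eq_abs, Real.norm_eq_abs] at hMV
      have hcl : |max 0 (min τ (a * T)) / a - max 0 (min σ (a * T)) / a| ≤ |τ - σ| / a := by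
        rw [← sub_div, abs_div, abs_of_pos ha0]
        exact div_le_div_of_nonneg_right (abs_clamp_sub_clamp_le τ σ _) ha0.le
      calc |frameJac E m (s + max 0 (min τ (a * T)) / a) s y p r - frameJac E m (s + max 0 (min σ (a * T)) / a) s y p r|
          ≤ 6 * (C' * S) * |max 0 (min τ (a * T)) / a - max 0 (min σ (a * T)) / a| := hMV
        _ ≤ 6 * (C' * S) * (|τ - σ| / a) := mul_le_mul_of_nonneg_left hcl (by positivity)
        _ = 6 * (C' * S) / a * |τ - σ| := by ring
    · -- a.e. derivative of `J`
      refine ⟨fun τ y => Matrix.of fun p r => (1 / a) • iterPartialDeriv [r]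
        (fun z => E.partialSum m (s + τ / a) (z + proj (E.disp m (s + τ / a) s z)) p) y, ae_restrict_Ioo_of_forall fun τ hτ y => ?_⟩
      refine hasDerivAt_pi.2 fun p => hasDerivAt_pi.2 fun r => ?_
      have h := hasDerivAt_comp_clamp_div (φ := fun u => frameJac E m (s + u) s y p r) ha0 (hJd y p r) hτ
      simpa only [Matrix.of_apply] using h
    · intro i j' l; exact (hSFG i j').2 l
    · -- a.e. derivative of `G = adj J`
      refine ⟨fun τ y => Matrix.of fun i l₀ => (1 / a) • (-(((frameJac E m (s + τ / a) s y).adjugate *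
        (Matrix.of fun p q => Torus.partialDeriv q (fun z => E.partialSum m (s + τ / a) z p)
          (E.X m (s + τ / a) s y))) i l₀)), ae_restrict_Ioo_of_forall fun τ hτ y => ?_⟩
      refine hasDerivAt_pi.2 fun i => hasDerivAt_pi.2 fun l₀ => ?_
      have hG : ∀ σ : ℝ, frameG E m (s + max 0 (min σ (a * T)) / a) s y i l₀ =
          (frameJac E m (s + max 0 (min σ (a * T)) / a) s y).adjugate i l₀ := fun σ => by
        rw [frameG_eq_adjugate_closed E hLR hF j hTR (hclI σ) y]
      have h := (hasDerivAt_comp_clamp_div (φ := fun u => (frameJac E m (s + u) s y).adjugate i l₀) ha0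
        (fun u hu => hasDerivWithinAt_adjugate_frameJac_entry_closed E hLR hF j hTR hT0 hu y i l₀) hτ).congr_of_eventuallyEq
        (Filter.Eventually.of_forall fun σ => hG σ)
      simpa only [Matrix.of_apply] using h
    · intro τ hτ y i j' l hl1 hl2
      exact hbound τ hτ y i j' l hl1 (hl2.trans (by norm_num))
  refine ⟨hreg, ⟨fun τ hτ y i j' l hl1 hl6 => hbound τ hτ y i j' l hl1 hl6⟩⟩

end Summit.AnomalousDissipation.AnomalousDissipation.Theorems.SolenoidalFractalHomogenisation.LagrangianStep.FrameInst

end
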